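import Summits.QuantumFields.YangMills.Theorems.UnitScaleTiltProp7CovariantTentPointwise
import Literature.MathematicalPhysics.QuantumFieldTheory.Balaban1983to89.B10StarCount
import Literature.MathematicalPhysics.QuantumFieldTheory.Balaban1983to89.B8Lemma1NonAbelian
import Literature.MathematicalPhysics.QuantumFieldTheory.Balaban1983to89.B10Eq27TorusAxialLog
import HarnessLib

/-!
# Route `UnitScaleTilt`, crux K1 «MinimiserStabilityRegPr» (stmt-QuantumFields-19200) — route-R E′ (A′), LANE II «DIVERGENCE RECOVERY AT CURVED `W`» (★★OWNER RULING №23),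
# brick (B2a), sub-pen F4 (★p1 g19 NAMER WORD №6 (3)), FILE F4-C: **COARSE STAIRCASE TELESCOPING ON A TORUS** — the transporter of a `{0,1}^d`-staircase of coarse bonds against the
# one-bond covariant differences `‖Ad(T c) w(c₊) − w(c₋)‖`, pointwise and summed over the torus

Cell `ym3-torus` ∕ width seat `ym3-torus-px3` (gen 6).  THEOREMS ONLY (0 `def`, 0 `sorry`), GENERIC over a torus `Site P j` of lit `Setup` and a normed ring `𝔸` with `‖1‖ = 1`;
`--supports stmt-QuantumFields-19200 --as helper`, count-neutral.  YM₃ on T³ is a ladder rung (R3), not d = 4, not the Clay problem; nothing here claims anything of print.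

WHY.  In the covariant tent quasi-interpolant `I_σ` (★p1 g19 SIGNATURE-0 (B2a); F4-A ✓`Prop7CovariantTentPointwise`) the frames of two boxes `Y₀` and `Y₀ − δ`, `δ ∈ {0,1}^d`, are compared
through the transporter of the coarse STAIRCASE `treeWord δ` from `Y₀ − δ` to `Y₀` built from the (B3) coarse transporters `T c`; the (B2a) rows are stated in the ONE-BOND currency
`c₀ℓ³·Σ_c ‖Ad(T c) w(c.src.shift c.dir) − w c.src‖²`.  This file bounds the staircase differences by that currency: pointwise by telescoping (`Ad(AB)f₂ − f₀ = Ad(A)(Ad(B)f₂ − f₁) + (Ad(A)f₁ − f₀)`,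
`‖Ad(A)·‖ ≤ ‖·‖` on `U1`), and summed over the torus by translation invariance (each run of the staircase, read from all base points, is each bond of its direction once).

CONTENTS (ns `…Theorems.Prop7CoarseStaircaseTelescoping`): §1 `norm_conjR_mul_sub_le_add` (one telescoping step), `holT_seg_one`∕`holT_seg_zero`, `transl_zsmul_e_one`, `sum_comp_transl_eq`
(translation invariance of torus sums); §2 ★★ `sum_norm_sq_conjR_holT_tw_le` (any list of directions, `{0,1}`-runs: `Σ_p ‖Ad(T(p; tw ks v)) w(p + v_ks) − w p‖² ≤ |ks|·Σ_{κ∈ks, vκ=1} Σ_p ‖Ad(T⟨p,κ⟩) w(p+e_κ) − w p‖²`);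
§3 ★★ `sum_norm_sq_conjR_holT_treeWord_le` (the `{0,1}^d` staircase: `≤ d·Σ_c ‖Ad(T c) w(c₊) − w(c₋)‖²`), ★★★ `sum_sum_norm_sq_conjR_holT_treeWord_inv_le` (summed over the `2^d` offsets, inverse
orientation as consumed by F4-A's `hfat`∕`P y` slot: `Σ_y Σ_δ ‖Ad(T(y − δ; treeWord δ))⁻¹ w(y − δ) − w y‖² ≤ 2^d·d·Σ_c ‖Ad(T c) w(c₊) − w(c₋)‖²`).
HONEST SCOPE.  Finite sums on a torus; no estimate of print; rung R3, not Clay; YM gap NOT proved.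

References: T. Bałaban, CMP **98** (1985) 17–51 [Balaban1985Averaging] ((8)–(9) p.18, pp.24–25 (tree words)); CMP **99** (1985) 389–434 [Balaban1985BackgroundPropagators] ((3.19) p.393).
-/

set_option autoImplicit false

noncomputable section

open scoped BigOperators

namespace Summit.QuantumFields.YangMills.Theorems.Prop7CoarseStaircaseTelescoping

open Literature.MathematicalPhysics.QuantumFieldTheory.Balaban1983to89
open B7Prop1Explicit renaming Site → LSite
open B7Prop1Explicit (U1 mem_U1 e e_apply seg seg_natCast seg_zero disp disp_nil disp_append disp_seg disp_treeWord treeWord Letter)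
open B7Eq78Linearization (conjR conjR_apply conjR_sub)
open B8Ineq132 (conjR_conjR norm_conjR_le norm_conjR)
open B8Lemma1NonAbelian (tw tw_nil tw_cons treeWord_eq_tw)
open B10Eq27TorusAxialLog (transl transl_apply transl_zero transl_add transl_add_e holT holT_nil holT_cons_true holT_append)
open B10StarCount (sum_pbond)
open Summit.QuantumFields.YangMills.Theorems.Prop7CovariantTentPointwise (norm_conjR_inv_sub_eq)

variable {𝔸 : Type*} [NormedRing 𝔸] [NormOneClass 𝔸]
variable {P : Params} {j : ℕ}

/-! ## §1 One telescoping step; runs of length `0` and `1`; translation invariance -/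

/-- One telescoping step: `‖Ad(AB)f₂ − f₀‖ ≤ ‖Ad(A)f₁ − f₀‖ + ‖Ad(B)f₂ − f₁‖` for `A ∈ U1`. [folklore; cite: Balaban1985Averaging, (8)-(9) p.18] -/
theorem norm_conjR_mul_sub_le_add {A B : 𝔸ˣ} (hA : A ∈ U1 𝔸) (f₀ f₁ f₂ : 𝔸) :
    ‖conjR (A * B) f₂ - f₀‖ ≤ ‖conjR A f₁ - f₀‖ + ‖conjR B f₂ - f₁‖ := by
  have h : conjR (A * B) f₂ - f₀ = conjR A (conjR B f₂ - f₁) + (conjR A f₁ - f₀) := by rw [conjR_sub, conjR_conjR]; abel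
  rw [h]
  calc _ ≤ ‖conjR A (conjR B f₂ - f₁)‖ + ‖conjR A f₁ - f₀‖ := norm_add_le _ _
    _ ≤ ‖conjR B f₂ - f₁‖ + ‖conjR A f₁ - f₀‖ := by gcongr; exact norm_conjR_le hA _
    _ = _ := add_comm _ _

omit [NormedRing 𝔸] [NormOneClass 𝔸] in
/-- A run of length one transports by the bond variable: `T(p; seg_κ 1) = T⟨p, κ⟩`. [cite: Balaban1985Averaging, (9) p.18] -/
theorem holT_seg_one {G : Type*} [Group G] (T : GaugeField P j G) (p : Site P j) (κ : Fin P.d) : holT T p (seg κ 1) = T ⟨p, κ⟩ := by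
  rw [show (1 : ℤ) = ((1 : ℕ) : ℤ) from rfl, seg_natCast, List.replicate_one, holT_cons_true, holT_nil, mul_one]

/-- `transl p (1 • e_κ) = p.shift κ`. [cite: Balaban1987RG1, (0.1) p.251] -/
theorem transl_one_zsmul_e (p : Site P j) (κ : Fin P.d) : transl p ((1 : ℤ) • e κ) = p.shift κ := by
  rw [one_zsmul, show (e κ : LSite P.d) = 0 + e κ from (zero_add _).symm, transl_add_e, transl_zero]

/-- **TRANSLATION INVARIANCE OF TORUS SUMS**: `Σ_p g(transl p z) = Σ_p g(p)`. [folklore; cite: Balaban1987RG1, (0.1) p.251] -/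
theorem sum_comp_transl_eq {M : Type*} [AddCommMonoid M] (z : LSite P.d) (g : Site P j → M) : ∑ p : Site P j, g (transl p z) = ∑ p : Site P j, g p :=
  Fintype.sum_equiv (Equiv.addRight (fun ν => ((z ν : ℤ) : ZMod (P.sitesPerDir j)))) _ _ fun p => by
    congr 1

/-! ## §2 Staircases over any list of directions with `{0,1}`-runs, summed over the torus -/

/-- ★★ **STAIRCASE TELESCOPING, SUMMED OVER THE TORUS**: for unit-ball transporters `T`, a list of directions `ks` and run lengths `v κ ∈ {0, 1}` (`κ ∈ ks`),
`Σ_p ‖Ad(T(p; tw ks v)) w(p + Σ_{κ∈ks} v κ e_κ) − w p‖² ≤ |ks| · Σ_{κ ∈ ks} [v κ = 1]·Σ_p ‖Ad(T⟨p, κ⟩) w(p + e_κ) − w p‖²`.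
[cite: Balaban1985Averaging, (8)-(9) p.18, pp.24-25] -/
theorem sum_norm_sq_conjR_holT_tw_le (T : GaugeField P j 𝔸ˣ) (hT : ∀ c, T c ∈ U1 𝔸) (w : Site P j → 𝔸) (v : LSite P.d) :
    ∀ ks : List (Fin P.d), (∀ κ ∈ ks, v κ = 0 ∨ v κ = 1) →
      ∑ p : Site P j, ‖conjR (holT T p (tw ks v)) (w (transl p (disp (tw ks v)))) - w p‖ ^ 2
        ≤ ks.length * (ks.map fun κ => if v κ = 1 then ∑ p : Site P j, ‖conjR (T ⟨p, κ⟩) (w (p.shift κ)) - w p‖ ^ 2 else 0).sum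
  | [], _ => by simp [conjR_apply]
  | κ :: ks, hv => by
    have hvκ := hv κ (by simp)
    have hks : ∀ κ' ∈ ks, v κ' = 0 ∨ v κ' = 1 := fun κ' h => hv κ' (List.mem_cons_of_mem κ h)
    have ih := sum_norm_sq_conjR_holT_tw_le T hT w v ks hks
    -- abbreviations
    set a : Site P j → ℝ := fun p => ‖conjR (holT T p (seg κ (v κ))) (w (transl p (v κ • e κ))) - w p‖ with ha
    set b : Site P j → ℝ := fun q => ‖conjR (holT T q (tw ks v)) (w (transl q (disp (tw ks v)))) - w q‖ with hb
    set Sκ : ℝ := if v κ = 1 then ∑ p : Site P j, ‖conjR (T ⟨p, κ⟩) (w (p.shift κ)) - w p‖ ^ 2 else 0 with hSκ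
    set Srest : ℝ := (ks.map fun κ => if v κ = 1 then ∑ p : Site P j, ‖conjR (T ⟨p, κ⟩) (w (p.shift κ)) - w p‖ ^ 2 else 0).sum with hSrest
    have hSrest0 : 0 ≤ Srest := by
      rw [hSrest]; refine List.sum_nonneg ?_
      intro x hx; rw [List.mem_map] at hx; obtain ⟨κ', _, rfl⟩ := hx
      split_ifs
      · exact Finset.sum_nonneg fun _ _ => sq_nonneg _
      · exact le_rfl
    -- pointwise telescoping: term(p) ≤ a(p) + b(p + v κ e κ)
    have hpt : ∀ p : Site P j, ‖conjR (holT T p (tw (κ :: ks) v)) (w (transl p (disp (tw (κ :: ks) v)))) - w p‖ ≤ a p + b (transl p (v κ • e κ)) := by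
      intro p
      rw [tw_cons, holT_append, disp_append, disp_seg, transl_add]
      have hA : holT T p (seg κ (v κ)) ∈ U1 𝔸 := by
        rcases hvκ with h0 | h1
        · rw [h0, seg_zero, holT_nil]; exact (U1 𝔸).one_mem
        · rw [h1, holT_seg_one]; exact hT _
      exact norm_conjR_mul_sub_le_add hA (w p) (w (transl p (v κ • e κ))) _
    have hap : ∀ p, a p = ‖conjR (holT T p (seg κ (v κ))) (w (transl p (v κ • e κ))) - w p‖ := fun p => rfl
    have hbq : ∀ q, b q = ‖conjR (holT T q (tw ks v)) (w (transl q (disp (tw ks v)))) - w q‖ := fun q => rfl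
    -- the run term, summed: `Σ_p a(p)² = Sκ`
    have hasum : ∑ p : Site P j, a p ^ 2 = Sκ := by
      rw [hSκ]
      rcases hvκ with h0 | h1
      · rw [if_neg (by rw [h0]; norm_num)]
        refine Finset.sum_eq_zero fun p _ => ?_
        rw [hap, h0, seg_zero, holT_nil, zero_smul, transl_zero, conjR_apply, Units.val_one, inv_one, Units.val_one, one_mul, mul_one, sub_self, norm_zero,
          zero_pow two_ne_zero]
      · rw [if_pos h1]
        refine Finset.sum_congr rfl fun p _ => ?_
        rw [hap, h1, holT_seg_one, transl_one_zsmul_e]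
    -- the tail, summed after translation: `Σ_p b(p + vκ eκ)² = Σ_q b(q)² ≤ |ks|·Srest`
    have hbsum : ∑ p : Site P j, b (transl p (v κ • e κ)) ^ 2 ≤ ks.length * Srest := by
      rw [sum_comp_transl_eq (v κ • e κ) (fun q => b q ^ 2)]
      exact ih
    -- combine with `(a + b)² ≤ (1 + m) a² + (1 + 1/m) b²` (resp. `= a²` if `m = 0`)
    rw [List.length_cons, List.map_cons, List.sum_cons, Nat.cast_succ, ← hSκ, ← hSrest]
    by_cases hm : ks.length = 0
    · have hks0 : ks = [] := List.eq_nil_of_length_eq_zero hm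
      have hS0 : Srest = 0 := by rw [hSrest, hks0]; simp
      have hb0 : ∀ q, b q = 0 := fun q => by
        rw [hbq, hks0, tw_nil, holT_nil, disp_nil, transl_zero, conjR_apply, Units.val_one, inv_one, Units.val_one, one_mul, mul_one, sub_self, norm_zero]
      rw [hm, hS0, Nat.cast_zero, zero_add, one_mul, add_zero, ← hasum]
      exact Finset.sum_le_sum fun p _ => by
        have h := hpt p; rw [hb0, add_zero] at h
        exact pow_le_pow_left₀ (norm_nonneg _) h 2
    · have hm1 : (1 : ℝ) ≤ (ks.length : ℝ) := by exact_mod_cast Nat.one_le_iff_ne_zero.mpr hm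
      set m : ℝ := (ks.length : ℝ) with hmdef
      have hm0 : 0 < m := by linarith
      have hquad : ∀ p : Site P j, ‖conjR (holT T p (tw (κ :: ks) v)) (w (transl p (disp (tw (κ :: ks) v)))) - w p‖ ^ 2
          ≤ (1 + m) * a p ^ 2 + (1 + m⁻¹) * b (transl p (v κ • e κ)) ^ 2 := by
        intro p
        have h := pow_le_pow_left₀ (norm_nonneg _) (hpt p) 2
        refine h.trans ?_
        have key : ∀ x y : ℝ, (x + y) ^ 2 ≤ (1 + m) * x ^ 2 + (1 + m⁻¹) * y ^ 2 := by
          intro x y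
          have h1 : 0 ≤ (Real.sqrt m * x - (Real.sqrt m)⁻¹ * y) ^ 2 := sq_nonneg _
          have hsq : Real.sqrt m ^ 2 = m := Real.sq_sqrt hm0.le
          have hsq' : (Real.sqrt m)⁻¹ ^ 2 = m⁻¹ := by rw [inv_pow, hsq]
          have hprod : Real.sqrt m * (Real.sqrt m)⁻¹ = 1 := mul_inv_cancel₀ (Real.sqrt_ne_zero'.mpr hm0)
          nlinarith [h1, hsq, hsq', hprod]
        exact key _ _
      calc ∑ p : Site P j, ‖conjR (holT T p (tw (κ :: ks) v)) (w (transl p (disp (tw (κ :: ks) v)))) - w p‖ ^ 2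
          ≤ ∑ p : Site P j, ((1 + m) * a p ^ 2 + (1 + m⁻¹) * b (transl p (v κ • e κ)) ^ 2) := Finset.sum_le_sum fun p _ => hquad p
        _ = (1 + m) * ∑ p : Site P j, a p ^ 2 + (1 + m⁻¹) * ∑ p : Site P j, b (transl p (v κ • e κ)) ^ 2 := by
            rw [Finset.sum_add_distrib, Finset.mul_sum, Finset.mul_sum]
        _ ≤ (1 + m) * Sκ + (1 + m⁻¹) * (m * Srest) := by
            rw [hasum]; gcongr
        _ = (m + 1) * (Sκ + Srest) := by field_simp; ring

/-! ## §3 The `{0,1}^d` staircase `treeWord δ` -/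

/-- ★★ **THE `{0,1}^d` STAIRCASE AGAINST THE ONE-BOND CURRENCY**: for `δ : Fin d → Fin 2`,
`Σ_p ‖Ad(T(p; treeWord δ)) w(p + δ) − w p‖² ≤ d · Σ_{c : PBond P j} ‖Ad(T c) w(c.src.shift c.dir) − w c.src‖²`. [cite: Balaban1985Averaging, pp.24-25, (8)-(9) p.18] -/
theorem sum_norm_sq_conjR_holT_treeWord_le (T : GaugeField P j 𝔸ˣ) (hT : ∀ c, T c ∈ U1 𝔸) (w : Site P j → 𝔸) (δ : Fin P.d → Fin 2) :
    ∑ p : Site P j, ‖conjR (holT T p (treeWord (fun i => ((δ i : ℕ) : ℤ)))) (w (transl p (fun i => ((δ i : ℕ) : ℤ)))) - w p‖ ^ 2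
      ≤ P.d * ∑ c : PBond P j, ‖conjR (T c) (w (c.src.shift c.dir)) - w c.src‖ ^ 2 := by
  set v : LSite P.d := fun i => ((δ i : ℕ) : ℤ) with hvdef
  have hv : ∀ κ ∈ (List.finRange P.d).reverse, v κ = 0 ∨ v κ = 1 := fun κ _ => by
    rcases Fin.exists_fin_two.mp ⟨δ κ, rfl⟩ with h | h
    · left; rw [hvdef]; simp [h]
    · right; rw [hvdef]; simp [h]
  have h := sum_norm_sq_conjR_holT_tw_le T hT w v _ hv
  rw [← treeWord_eq_tw, disp_treeWord, List.length_reverse, List.length_finRange] at h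
  refine h.trans (mul_le_mul_of_nonneg_left ?_ (Nat.cast_nonneg _))
  -- each direction's bond sum appears at most once; bound the list sum by the full bond sum
  have hnn : ∀ κ : Fin P.d, 0 ≤ ∑ p : Site P j, ‖conjR (T ⟨p, κ⟩) (w (p.shift κ)) - w p‖ ^ 2 := fun κ => Finset.sum_nonneg fun _ _ => sq_nonneg _
  calc ((List.finRange P.d).reverse.map fun κ => if v κ = 1 then ∑ p : Site P j, ‖conjR (T ⟨p, κ⟩) (w (p.shift κ)) - w p‖ ^ 2 else 0).sum
      ≤ ((List.finRange P.d).reverse.map fun κ => ∑ p : Site P j, ‖conjR (T ⟨p, κ⟩) (w (p.shift κ)) - w p‖ ^ 2).sum := by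
        refine List.sum_le_sum fun κ _ => ?_
        split_ifs
        · exact le_rfl
        · exact hnn κ
    _ = ∑ κ : Fin P.d, ∑ p : Site P j, ‖conjR (T ⟨p, κ⟩) (w (p.shift κ)) - w p‖ ^ 2 := by
        rw [List.map_reverse, List.sum_reverse, ← Fin.sum_univ_def]
    _ = ∑ c : PBond P j, ‖conjR (T c) (w (c.src.shift c.dir)) - w c.src‖ ^ 2 := by
        rw [sum_pbond, Finset.sum_comm]

/-- ★★★ **SUMMED OVER THE `2^d` OFFSETS, INVERSE ORIENTATION** (the shape consumed by F4-A's `hfat` slot `P y := (T(y − δ; treeWord δ))⁻¹`):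
`Σ_y Σ_δ ‖Ad(T(y − δ; treeWord δ))⁻¹ w(y − δ) − w y‖² ≤ 2^d · d · Σ_c ‖Ad(T c) w(c.src.shift c.dir) − w c.src‖²`. [cite: Balaban1985Averaging, pp.24-25, (8)-(9) p.18] -/
theorem sum_sum_norm_sq_conjR_holT_treeWord_inv_le (T : GaugeField P j 𝔸ˣ) (hT : ∀ c, T c ∈ U1 𝔸) (w : Site P j → 𝔸) :
    ∑ y : Site P j, ∑ δ : Fin P.d → Fin 2,
        ‖conjR (holT T (transl y (-fun i => ((δ i : ℕ) : ℤ))) (treeWord (fun i => ((δ i : ℕ) : ℤ))))⁻¹ (w (transl y (-fun i => ((δ i : ℕ) : ℤ)))) - w y‖ ^ 2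
      ≤ 2 ^ P.d * P.d * ∑ c : PBond P j, ‖conjR (T c) (w (c.src.shift c.dir)) - w c.src‖ ^ 2 := by
  rw [Finset.sum_comm]
  have hTw : ∀ (q : Site P j) (wd : List (Letter P.d)), holT T q wd ∈ U1 𝔸 := fun q wd => by
    rw [← B10Eq27TorusAxialLog.hol_pull_zero]; exact B7Prop1Explicit.hol_mem (fun z κ => hT _) _ _
  have hδ : ∀ δ : Fin P.d → Fin 2,
      ∑ y : Site P j, ‖conjR (holT T (transl y (-fun i => ((δ i : ℕ) : ℤ))) (treeWord (fun i => ((δ i : ℕ) : ℤ))))⁻¹ (w (transl y (-fun i => ((δ i : ℕ) : ℤ)))) - w y‖ ^ 2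
        ≤ P.d * ∑ c : PBond P j, ‖conjR (T c) (w (c.src.shift c.dir)) - w c.src‖ ^ 2 := by
    intro δ
    set v : LSite P.d := fun i => ((δ i : ℕ) : ℤ) with hvdef
    -- reindex `y = transl q v`
    have hre : ∑ y : Site P j, ‖conjR (holT T (transl y (-v)) (treeWord v))⁻¹ (w (transl y (-v))) - w y‖ ^ 2
        = ∑ q : Site P j, ‖conjR (holT T q (treeWord v))⁻¹ (w q) - w (transl q v)‖ ^ 2 := by
      rw [← sum_comp_transl_eq v (fun y => ‖conjR (holT T (transl y (-v)) (treeWord v))⁻¹ (w (transl y (-v))) - w y‖ ^ 2)]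
      refine Finset.sum_congr rfl fun q _ => ?_
      rw [← transl_add, add_neg_cancel, transl_zero]
    rw [hre]
    have hflip : ∀ q : Site P j, ‖conjR (holT T q (treeWord v))⁻¹ (w q) - w (transl q v)‖ = ‖conjR (holT T q (treeWord v)) (w (transl q v)) - w q‖ := fun q =>
      norm_conjR_inv_sub_eq (hTw q _) _ _
    simp only [hflip]
    exact sum_norm_sq_conjR_holT_treeWord_le T hT w δ
  calc ∑ δ : Fin P.d → Fin 2, ∑ y : Site P j,
        ‖conjR (holT T (transl y (-fun i => ((δ i : ℕ) : ℤ))) (treeWord (fun i => ((δ i : ℕ) : ℤ))))⁻¹ (w (transl y (-fun i => ((δ i : ℕ) : ℤ)))) - w y‖ ^ 2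
      ≤ ∑ _δ : Fin P.d → Fin 2, (P.d : ℝ) * ∑ c : PBond P j, ‖conjR (T c) (w (c.src.shift c.dir)) - w c.src‖ ^ 2 := Finset.sum_le_sum fun δ _ => hδ δ
    _ = 2 ^ P.d * P.d * ∑ c : PBond P j, ‖conjR (T c) (w (c.src.shift c.dir)) - w c.src‖ ^ 2 := by
        rw [Finset.sum_const, Finset.card_univ, nsmul_eq_mul, Fintype.card_fun, Fintype.card_fin, Fintype.card_fin]; push_cast; ring

end Summit.QuantumFields.YangMills.Theorems.Prop7CoarseStaircaseTelescoping

end
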